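import Summits.QuantumFields.BalabanUV.Beta.GAN24.StripLegUnits
import Summits.QuantumFields.BalabanUV.Beta.GAN24.ArrowScaling
import Summits.QuantumFields.BalabanUV.Beta.GAN24.ArrowAnchorRealCapRadius
import Summits.QuantumFields.BalabanUV.Beta.GAN24.ArrowInnerShiftBlocks

/-!
# `BalabanUV.Beta.GAN24.StripLegApriori` — binder row G-an2-4 / (CONV-C), road P1-fibre, row **P1-L10** `FibreStrip` ((I3′)), cut «(M4) scaled alias-space
# Neumann, two anchors» (`HOME/b2b-balaban-gan24-formalise-leaf-16/L10-CUT-M4.md`), module **F8 part 4 (the END of F8)**: (U2) IN F1c's CURRENCY —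
# `‖kFibΔ_j‖ ≤ √cstSq` on the strip from `IsUnit` + an operator-norm bound of the inverse of leaf-16's SCALED arrow matrix (`ArrowScaling.scaledArrow`,
# in particular `innerArrow` / `outerArrow`), i.e. from exactly what F7 (`FibreDetStripOfAnchors` instantiated) delivers

NOT IN PRINT; OUR PROOF ATTEMPT (of the road; THIS file is [folklore] bookkeeping).  HONEST FRAMING (cell contract, verbatim): «discharging `BetaPertH` makes
Bałaban's UV stability UNCONDITIONAL — a real constructive-QFT result; it is NOT the continuum limit and NOT the Clay problem.»  HONEST DEPENDENCY (verbatim):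
«continuum YM on T⁴ ⇐ BetaPertH ∧ nine spine estimates (0/9 proved); BetaPertH ⇐ (D1) ∧ (D4) ∧ CAP+tail; G-an2-4 gates asym, D1 and NE2/3/4.»  No cited fact,
no wall binder, no `def … : Prop` fact; nothing of the K-slot of (CONV-C) is discharged here (F7's invertibility + inverse bound is a HYPOTHESIS).  NOT summit progress.

## What is proved
* §1 the cut's weights as REAL vectors on the arrow index (`sigmaR`, `rhoR` = leaf-16's `colLoc/colBor`, `rowLoc/rowBor` re-packed; `colVec_eq`, `rowVec_eq`),
  their values on the A-slots / φ-slots / EL rows / Q rows, positivity; the OUTER radii of the cut are `≥ 2` off the zero alias (`two_le_radO`, from leaf-17's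
  `four_le_sq_mul_lapR`; the inner twin `two_le_radI` and `radI_zero` are leaf-04's `ArrowInnerShiftBlocks` / leaf-15's `ArrowAnchorZero`, BY NAME).
* §2 **`apriori_sq_of_scaledArrow`**: `IsUnit (arrowMat (scaledArrow N r r₀ p))` and `‖(arrowMat (scaledArrow N r r₀ p))⁻¹‖ ≤ A` give the squared
  a-priori form of part 2 for `arrowMat (aliasArrow N p)` with weights `(sigmaR, rhoR)` (leaf-16's `arrowMat_scale` + part 2's `apriori_sq_of_scaled_inv`).
* §3 (`d = 3`) **`norm_kFibΔ_le_of_scaledArrow`**: for radii `r` with `0 < r m`, `2 ≤ r m` (`m ≠ 0`), `r 0 = r₀ > 0`: F7's pair (IsUnit, `‖inverse‖ ≤ A`) at a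
  strip point `p` (`|Im p_i| ≤ η ≤ 1/4`, `|Re p_i| ≤ π`) gives `‖kFibΔ Lc (sfStep Lc) (smStep 3 Lc) j a x′ b y′ p‖ ≤ √(cstSq A η Lc r₀)` for ALL legs and base
  points; the two instances **`norm_kFibΔ_le_of_innerArrow`** (`r₀ = 1`) and **`norm_kFibΔ_le_of_outerArrow`** (`r₀ = radO N q 0`).  With part 3's
  `cstSq_mono` and the radius window of the outer anchor this is (U2) with ONE `Cst`:
* §4 **`norm_kFibΔ_le_of_alternative`**: from EXACTLY the conclusion of leaf-09's `FibreDetStrip.apriori_of_rows_step` at a strip point `p` (inner pair with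
  `2aZ` OR outer pair at the anchor `reVec p` with `2aR` and some `|Re p_μ| ≥ ρ₀/2`) ⇒ `‖kFibΔ …‖ ≤ cstU aZ aR η Lc ρ₀ := max √(cstSq (2aZ) η Lc 1)
  √(cstEnv (2aR) η Lc (ρ₀/π) (2π))` — ONE `N`-free, `p`-free constant (radius window `ρ₀/π ≤ radO N (Re p) 0 ≤ 2π`: leaf-12's
  `two_div_pi_mul_rad_le_radO`, `CapacitanceScalarBounds.sq_mul_lapR_zero_le`, King's `momSq_le_card_mul_pi_sq` BY NAME).  F9 = this + F7's `detStrip` +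
  `StripRegularPackaging.stripRegularK_of_det_bound` (with `κ₀ ≤ 1/4`).
Unit `b2b-balaban-gan24-p1` (row G-an2-4 owner, gen 2), 2026-08-20.
-/

noncomputable section

open Complex Finset Matrix
open scoped BigOperators Real Matrix.Norms.L2Operator
open Literature.Probability.LatticeModels (TorusSite)
open Literature.MathematicalPhysics.QuantumFieldTheory
open Literature.MathematicalPhysics.QuantumFieldTheory.LatticeForm (repZ)
open Literature.MathematicalPhysics.QuantumFieldTheory.Balaban1983to89
open Literature.MathematicalPhysics.QuantumFieldTheory.Balaban1983to89.Beta
open OneStepResolventKernel (Fib)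
open Summit.QuantumFields.BalabanUV.Beta.GAN24.CombesThomas (sfStep smStep)
open Summit.QuantumFields.BalabanUV.Beta.GAN24.CombesThomasFibreStep (kFibΔ)
open Summit.QuantumFields.BalabanUV.Beta.GAN24.AliasWeights (kfine)
open Literature.MathematicalPhysics.QuantumFieldTheory.King1986 (momSq momSq_nonneg momSq_le_card_mul_pi_sq)
open B4Strip (reVec)
open Summit.QuantumFields.BalabanUV.Beta.GAN24.AliasWeightsSum (lapR lapR_nonneg four_le_sq_mul_lapR)
open Summit.QuantumFields.BalabanUV.Beta.GAN24.CapacitanceScalarBounds (sq_mul_lapR_zero_le)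
open Summit.QuantumFields.BalabanUV.Beta.GAN24.ArrowAnchorRealCap (rad rad_nonneg)
open Summit.QuantumFields.BalabanUV.Beta.GAN24.ArrowAnchorRealCapRadius (two_div_pi_mul_rad_le_radO)
open Summit.QuantumFields.BalabanUV.Beta.GAN24.ArrowOperator (AIdx Loc ArrowData arrowMat aliasArrow)
open Summit.QuantumFields.BalabanUV.Beta.GAN24.ArrowScaling
  (rowVec colVec arrowMat_scale rowLoc colLoc rowBor colBor radO radI scaledArrow innerArrow outerArrow radO_pos radI_pos sq_radO sq_radI)
open Summit.QuantumFields.BalabanUV.Beta.GAN24.ArrowAnchorZero (radI_zero)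
open Summit.QuantumFields.BalabanUV.Beta.GAN24.ArrowInnerShiftBlocks (two_le_radI)
open Summit.QuantumFields.BalabanUV.Beta.GAN24.StripLegReadout (apriori_sq_of_scaled_inv)
open Summit.QuantumFields.BalabanUV.Beta.GAN24.StripLegUnits (cstSq cstSq_nonneg cstSq_mono norm_kFibΔ_le_sqrt_cstSq)

namespace Summit.QuantumFields.BalabanUV.Beta.GAN24.StripLegApriori

/-! ## §1 The cut's weights as real vectors; radii off the zero alias -/

section Weights

variable {D : ℕ} {ι : Type*}

/-- [folklore] The COLUMN weights of the cut as one real vector on the arrow index (leaf-16's `colLoc` ⊕ `colBor`). -/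
def sigmaR (N : ℕ) (r : ι → ℝ) (r0 : ℝ) : AIdx D ι → ℝ := Sum.elim (fun i => colLoc N r i.2 i.1) (colBor N r0)

/-- [folklore] The ROW weights of the cut as one real vector on the arrow index (leaf-16's `rowLoc` ⊕ `rowBor`). -/
def rhoR (D N : ℕ) (r : ι → ℝ) (r0 : ℝ) : AIdx D ι → ℝ := Sum.elim (fun i => rowLoc N r i.2 i.1) (rowBor D N r0)

/-- [folklore] `colVec = ↑sigmaR`. -/
theorem colVec_eq (N : ℕ) (r : ι → ℝ) (r0 : ℝ) : colVec (D := D) (colLoc N r) (colBor N r0) = fun i => ((sigmaR N r r0 i : ℝ) : ℂ) := by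
  funext i; rcases i with ⟨s, m⟩ | s <;> rfl

/-- [folklore] `rowVec = ↑rhoR`. -/
theorem rowVec_eq (N : ℕ) (r : ι → ℝ) (r0 : ℝ) : rowVec (D := D) (rowLoc N r) (rowBor D N r0) = fun i => ((rhoR D N r r0 i : ℝ) : ℂ) := by
  funext i; rcases i with ⟨s, m⟩ | s <;> rfl

/-- [folklore] A-slot column weight `= 1`. -/
@[simp] theorem sigmaR_A (N : ℕ) (r : ι → ℝ) (r0 : ℝ) (κ : Fin D) (m : ι) :
    sigmaR (D := D) N r r0 (Sum.inl (Sum.inl κ, m)) = 1 := rfl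
/-- [folklore] φ-slot column weight `= r₀²/N³`. -/
@[simp] theorem sigmaR_phi (N : ℕ) (r : ι → ℝ) (r0 : ℝ) (κ : Fin D) :
    sigmaR (D := D) (ι := ι) N r r0 (Sum.inr (Sum.inl κ)) = r0 ^ 2 / (N : ℝ) ^ 3 := rfl
/-- [folklore] EL-row weight `= N²/r_m²`. -/
@[simp] theorem rhoR_EL (N : ℕ) (r : ι → ℝ) (r0 : ℝ) (κ : Fin D) (m : ι) :
    rhoR D N r r0 (Sum.inl (Sum.inl κ, m)) = (N : ℝ) ^ 2 / r m ^ 2 := rfl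
/-- [folklore] Q-row weight `= N^{−(D+1)}`. -/
@[simp] theorem rhoR_Q (N : ℕ) (r : ι → ℝ) (r0 : ℝ) (κ : Fin D) :
    rhoR D (ι := ι) N r r0 (Sum.inr (Sum.inl κ)) = ((N : ℝ) ^ (D + 1))⁻¹ := rfl

/-- [folklore] All column weights are positive (`0 < r m`, `0 < r₀`, `0 < N`). -/
theorem sigmaR_pos {N : ℕ} (hN : 0 < N) {r : ι → ℝ} (hr : ∀ m, 0 < r m) {r0 : ℝ} (hr0 : 0 < r0) (i : AIdx D ι) : 0 < sigmaR N r r0 i := by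
  have hN' : (0 : ℝ) < N := by exact_mod_cast hN
  rcases i with ⟨s | s, m⟩ | (s | s) <;> simp only [sigmaR, Sum.elim_inl, Sum.elim_inr, colLoc, colBor]
  · exact one_pos
  · exact div_pos hN' (hr m)
  · positivity
  · positivity

end Weights

section Radii

variable {D N : ℕ} [NeZero N]

/-- [folklore] The OUTER radius is `≥ 2` off the zero alias (`4 ≤ N²·lapR`, leaf-17). -/
theorem two_le_radO {q : Fin D → ℝ} (hq : ∀ i, |q i| ≤ π) {m : TorusSite D N} (hm : m ≠ 0) : 2 ≤ radO N q m := by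
  have h4 := four_le_sq_mul_lapR (N := N) hq hm
  have h0 : 0 ≤ radO N q m := by unfold radO; positivity
  nlinarith [sq_radO (N := N) q m]

end Radii

/-! ## §2 F7's currency ⇒ the squared a-priori form of part 2 -/

section Apriori

variable {D N : ℕ} [NeZero N]

/-- [folklore] **FROM THE SCALED ARROW MATRIX TO THE A-PRIORI FORM**: invertibility of `arrowMat (scaledArrow N r r₀ p)` with `‖inverse‖ ≤ A` gives
`Σ_i (‖x_i‖/σ_i)² ≤ A²·Σ_i (ρ_i‖(arrowMat (aliasArrow N p) x)_i‖)²` with `(σ, ρ) = (sigmaR, rhoR)`. -/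
theorem apriori_sq_of_scaledArrow {r : TorusSite D N → ℝ} (hr : ∀ m, 0 < r m) {r0 : ℝ} (hr0 : 0 < r0) (p : Fin D → ℂ) {A : ℝ}
    (hU : IsUnit (arrowMat (scaledArrow N r r0 p))) (hA : ‖(arrowMat (scaledArrow N r r0 p))⁻¹‖ ≤ A)
    (x : AIdx D (TorusSite D N) → ℂ) :
    ∑ i, (‖x i‖ / sigmaR N r r0 i) ^ 2 ≤ A ^ 2 * ∑ i, (rhoR D N r r0 i * ‖(arrowMat (aliasArrow N p) *ᵥ x) i‖) ^ 2 := by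
  have hscale : arrowMat (scaledArrow N r r0 p) =
      Matrix.diagonal (fun i => ((rhoR D N r r0 i : ℝ) : ℂ)) * arrowMat (aliasArrow N p) * Matrix.diagonal (fun i => ((sigmaR N r r0 i : ℝ) : ℂ)) := by
    unfold scaledArrow
    rw [arrowMat_scale, rowVec_eq, colVec_eq]
  rw [hscale] at hU hA
  have hσ : ∀ i : AIdx D (TorusSite D N), sigmaR N r r0 i ≠ 0 := fun i =>
    (sigmaR_pos (D := D) (Nat.pos_of_ne_zero (NeZero.ne N)) hr hr0 i).ne'
  exact apriori_sq_of_scaled_inv _ _ _ hσ hU hA x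

end Apriori

/-! ## §3 The step family at `d = 3`: (U2) from F7's pair, inner and outer instances -/

section StepThree

variable {Lc : ℕ} [NeZero Lc] {η A : ℝ}

/-- [folklore] **(U2) FROM F7's PAIR, GENERIC RADII** (`d = 3`, step `j`, `N = Lc^(j+1)`): for radii `r` positive, `≥ 2` off the zero alias and `r 0 = r₀ > 0`,
invertibility of the scaled arrow matrix at the strip point `p` with `‖inverse‖ ≤ A` bounds every leg entry: `‖kFibΔ …‖ ≤ √(cstSq A η Lc r₀)`. -/
theorem norm_kFibΔ_le_of_scaledArrow (hη : 0 ≤ η) (hη4 : η ≤ 1 / 4) (j : ℕ) {p : Fin 4 → ℂ}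
    (him : ∀ i, |(p i).im| ≤ η) (hre : ∀ i, |(p i).re| ≤ π)
    (r : TorusSite 4 (Lc ^ (j + 1)) → ℝ) {r0 : ℝ} (hr : ∀ m, 0 < r m) (hr2 : ∀ m, m ≠ 0 → 2 ≤ r m) (hr0 : 0 < r0) (hr00 : r 0 = r0)
    (hU : IsUnit (arrowMat (scaledArrow (Lc ^ (j + 1)) r r0 p))) (hA : ‖(arrowMat (scaledArrow (Lc ^ (j + 1)) r r0 p))⁻¹‖ ≤ A)
    (a b : Fib 3) (x' y' : Fin 4 → ℤ) :
    ‖kFibΔ Lc (sfStep Lc) (smStep 3 Lc) j a x' b y' p‖ ≤ Real.sqrt (cstSq A η Lc r0) := by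
  have hN : 0 < Lc ^ (j + 1) := pow_pos (Nat.pos_of_ne_zero (NeZero.ne Lc)) _
  have hNR : ((Lc ^ (j + 1) : ℕ) : ℝ) = (Lc : ℝ) ^ (j + 1) := by push_cast; rfl
  have hAP := apriori_sq_of_scaledArrow hr hr0 p hU hA
  refine norm_kFibΔ_le_sqrt_cstSq hη hη4 hr0 j him hre (sigmaR (Lc ^ (j + 1)) r r0) (rhoR 4 (Lc ^ (j + 1)) r r0)
    (sigmaR_pos hN hr hr0) (fun m κ => le_of_eq (sigmaR_A _ _ _ κ m)) (fun κ => ?_) (fun κ => ?_) (fun m hm κ => ?_) (fun κ => ?_) hAP a b x' y'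
  · rw [sigmaR_phi, hNR]
  · rw [rhoR_EL, hr00, hNR, abs_of_nonneg (by positivity)]
  · rw [rhoR_EL, hNR, abs_of_nonneg (by positivity)]
    have h2 := hr2 m hm
    have h4 : (4 : ℝ) ≤ r m ^ 2 := by nlinarith
    exact div_le_div_of_nonneg_left (by positivity) (by norm_num) h4
  · rw [rhoR_Q, hNR, abs_of_nonneg (by positivity)]

/-- [folklore] **(U2) FROM F7's INNER PAIR**: `IsUnit (arrowMat (innerArrow N p))`, `‖inverse‖ ≤ A` ⇒ `‖kFibΔ …‖ ≤ √(cstSq A η Lc 1)`. -/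
theorem norm_kFibΔ_le_of_innerArrow (hη : 0 ≤ η) (hη4 : η ≤ 1 / 4) (j : ℕ) {p : Fin 4 → ℂ}
    (him : ∀ i, |(p i).im| ≤ η) (hre : ∀ i, |(p i).re| ≤ π)
    (hU : IsUnit (arrowMat (innerArrow (Lc ^ (j + 1)) p))) (hA : ‖(arrowMat (innerArrow (Lc ^ (j + 1)) p))⁻¹‖ ≤ A)
    (a b : Fib 3) (x' y' : Fin 4 → ℤ) :
    ‖kFibΔ Lc (sfStep Lc) (smStep 3 Lc) j a x' b y' p‖ ≤ Real.sqrt (cstSq A η Lc 1) :=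
  norm_kFibΔ_le_of_scaledArrow hη hη4 j him hre (radI (Lc ^ (j + 1))) radI_pos (fun _ hm => two_le_radI hm) one_pos radI_zero hU hA a b x' y'

/-- [folklore] **(U2) FROM F7's OUTER PAIR** (anchor `q ∈ [−π,π]⁴ ∖ {0}`): `IsUnit (arrowMat (outerArrow N q p))`, `‖inverse‖ ≤ A` ⇒
`‖kFibΔ …‖ ≤ √(cstSq A η Lc (radO N q 0))` (the zero-alias radius of the outer anchor; part 3's `cstSq_mono` makes it uniform on the outer region). -/
theorem norm_kFibΔ_le_of_outerArrow (hη : 0 ≤ η) (hη4 : η ≤ 1 / 4) (j : ℕ) {p : Fin 4 → ℂ}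
    (him : ∀ i, |(p i).im| ≤ η) (hre : ∀ i, |(p i).re| ≤ π) {q : Fin 4 → ℝ} (hq : ∀ i, |q i| ≤ π) (hq0 : q ≠ 0)
    (hU : IsUnit (arrowMat (outerArrow (Lc ^ (j + 1)) q p))) (hA : ‖(arrowMat (outerArrow (Lc ^ (j + 1)) q p))⁻¹‖ ≤ A)
    (a b : Fib 3) (x' y' : Fin 4 → ℤ) :
    ‖kFibΔ Lc (sfStep Lc) (smStep 3 Lc) j a x' b y' p‖ ≤ Real.sqrt (cstSq A η Lc (radO (Lc ^ (j + 1)) q 0)) :=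
  norm_kFibΔ_le_of_scaledArrow hη hη4 j him hre (radO (Lc ^ (j + 1)) q) (radO_pos hq hq0) (fun _ hm => two_le_radO hq hm)
    (radO_pos hq hq0 0) rfl hU hA a b x' y'

end StepThree

/-! ## §4 One constant on the whole strip: the alternative form (F7's `apriori_of_rows_step` ⇒ (U2)) -/

section Uniform

variable {N : ℕ} [NeZero N]

/-- [folklore] THE OUTER ZERO-ALIAS RADIUS IS AT MOST `2π` on `[−π,π]⁴` (`(radO)² = N²·lapR ≤ |q|² ≤ 4π²`). -/
theorem radO_zero_le_two_pi {q : Fin 4 → ℝ} (hq : ∀ i, |q i| ≤ π) : radO N q 0 ≤ 2 * π := by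
  have hN : 1 ≤ N := Nat.one_le_iff_ne_zero.2 (NeZero.ne N)
  have h1 : radO N q 0 ^ 2 ≤ (2 * π) ^ 2 := by
    rw [sq_radO]
    calc (N : ℝ) ^ 2 * lapR (kfine N q 0) ≤ momSq q := sq_mul_lapR_zero_le hN q
      _ ≤ (4 : ℕ) * π ^ 2 := momSq_le_card_mul_pi_sq hq
      _ = (2 * π) ^ 2 := by push_cast; ring
  have h0 : 0 ≤ radO N q 0 := by unfold radO; positivity
  exact (pow_le_pow_iff_left₀ h0 (by positivity) two_ne_zero).1 h1

/-- [folklore] THE OUTER ZERO-ALIAS RADIUS IS AT LEAST `ρ₀/π` when some `|q_μ| ≥ ρ₀/2` (`(2/π)|q|₂ ≤ radO`, leaf-12). -/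
theorem rho_div_pi_le_radO_zero {q : Fin 4 → ℝ} (hq : ∀ i, |q i| ≤ π) {ρ₀ : ℝ} {μ : Fin 4} (hμ : ρ₀ / 2 ≤ |q μ|) :
    ρ₀ / π ≤ radO N q 0 := by
  have hN : 1 ≤ N := Nat.one_le_iff_ne_zero.2 (NeZero.ne N)
  have hπ : 0 < π := Real.pi_pos
  have hrad : |q μ| ≤ rad q := by
    unfold rad
    rw [← Real.sqrt_sq (abs_nonneg (q μ)), sq_abs]
    exact Real.sqrt_le_sqrt (Finset.single_le_sum (f := fun ν => q ν ^ 2) (fun ν _ => sq_nonneg _) (Finset.mem_univ μ))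
  have h2 := two_div_pi_mul_rad_le_radO (D := 4) (N := N) hN hq
  calc ρ₀ / π = 2 / π * (ρ₀ / 2) := by field_simp
    _ ≤ 2 / π * |q μ| := mul_le_mul_of_nonneg_left hμ (by positivity)
    _ ≤ 2 / π * rad q := mul_le_mul_of_nonneg_left hrad (by positivity)
    _ ≤ radO N q 0 := h2

end Uniform

section Alternative

variable {Lc : ℕ} [NeZero Lc] {η aZ aR ρ₀ : ℝ}

/-- [folklore] THE ENVELOPE of `cstSq` over a radius window `[ρ₁, ρ₂]` (`r₀⁻⁴ ↦ ρ₁⁻⁴`, `r₀⁴ ↦ ρ₂⁴`; the right-hand side of part 3's `cstSq_mono`). -/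
def cstEnv (A η : ℝ) (Lc : ℕ) (ρ₁ ρ₂ : ℝ) : ℝ :=
  A ^ 2 * (Real.exp (η * (4 * Lc)) ^ 4 * ((6 : ℝ) ^ 10 * (5 : ℝ) ^ 4 * (Lc : ℝ) ^ 12) * (ρ₁⁻¹ ^ 4 + 39)
    + Real.exp (η * (4 * Lc)) ^ 2 * ((6 : ℝ) ^ 5 * (5 : ℝ) ^ 4) * ((Lc : ℝ) ^ 2)⁻¹
    + Real.exp (η * (4 * Lc)) ^ 2 * (6 : ℝ) ^ 5 * (1 + 39 * ρ₂ ^ 4) * ((Lc : ℝ) ^ 2)⁻¹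
    + ρ₂ ^ 4 * ((Lc : ℝ) ^ 16)⁻¹)

/-- [folklore] `cstSq ≤ cstEnv` on the window (part 3's `cstSq_mono`). -/
theorem cstSq_le_cstEnv {A η ρ₁ ρ₂ r₀ : ℝ} {Lc : ℕ} (hρ₁ : 0 < ρ₁) (h1 : ρ₁ ≤ r₀) (h2 : r₀ ≤ ρ₂) :
    cstSq A η Lc r₀ ≤ cstEnv A η Lc ρ₁ ρ₂ := by
  unfold cstEnv
  exact cstSq_mono hρ₁ h1 h2

/-- [folklore] **THE UNIFORM CONSTANT OF (U2)** from the two anchors' data `(aZ, aR, ρ₀)`: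
`cstU aZ aR η Lc ρ₀ = max √(cstSq (2aZ) η Lc 1) √(cstEnv (2aR) η Lc (ρ₀/π) (2π))` — `N`-free, `p`-free. -/
def cstU (aZ aR η : ℝ) (Lc : ℕ) (ρ₀ : ℝ) : ℝ :=
  max (Real.sqrt (cstSq (2 * aZ) η Lc 1)) (Real.sqrt (cstEnv (2 * aR) η Lc (ρ₀ / π) (2 * π)))

/-- [folklore] **(U2) FROM THE ALTERNATIVE** — the conclusion of leaf-09's `FibreDetStrip.apriori_of_rows_step` at a point `p` of `Strip 4 κ₀` (`κ₀ ≤ η ≤ 1/4`),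
read as a hypothesis: EITHER the inner pair `IsUnit (arrowMat (innerArrow N p)) ∧ ‖⁻¹‖ ≤ 2aZ`, OR (some `|Re p_μ| ≥ ρ₀/2`, `Re p ≠ 0`) the outer pair at the
anchor `Re p` with `2aR` ⇒ `‖kFibΔ Lc (sfStep Lc) (smStep 3 Lc) j a x′ b y′ p‖ ≤ cstU aZ aR η Lc ρ₀` for ALL legs and base points. -/
theorem norm_kFibΔ_le_of_alternative (hη : 0 ≤ η) (hη4 : η ≤ 1 / 4) (hρ₀ : 0 < ρ₀) (j : ℕ) {p : Fin 4 → ℂ}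
    (him : ∀ i, |(p i).im| ≤ η) (hre : ∀ i, |(p i).re| ≤ π)
    (halt : ((∀ μ, |(p μ).re| < ρ₀ / 2) ∧ IsUnit (arrowMat (innerArrow (Lc ^ (j + 1)) p)) ∧
        ‖(arrowMat (innerArrow (Lc ^ (j + 1)) p))⁻¹‖ ≤ 2 * aZ) ∨
      ((∃ μ, ρ₀ / 2 ≤ |(p μ).re|) ∧ reVec p ≠ 0 ∧ IsUnit (arrowMat (outerArrow (Lc ^ (j + 1)) (reVec p) p)) ∧
        ‖(arrowMat (outerArrow (Lc ^ (j + 1)) (reVec p) p))⁻¹‖ ≤ 2 * aR))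
    (a b : Fib 3) (x' y' : Fin 4 → ℤ) :
    ‖kFibΔ Lc (sfStep Lc) (smStep 3 Lc) j a x' b y' p‖ ≤ cstU aZ aR η Lc ρ₀ := by
  rcases halt with ⟨-, hU, hA⟩ | ⟨⟨μ, hμ⟩, hq0, hU, hA⟩
  · exact (norm_kFibΔ_le_of_innerArrow hη hη4 j him hre hU hA a b x' y').trans (le_max_left _ _)
  · have hq : ∀ i, |reVec p i| ≤ π := hre
    have h1 := norm_kFibΔ_le_of_outerArrow hη hη4 j him hre hq hq0 hU hA a b x' y'
    refine h1.trans ((Real.sqrt_le_sqrt ?_).trans (le_max_right _ _))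
    exact cstSq_le_cstEnv (div_pos hρ₀ Real.pi_pos) (rho_div_pi_le_radO_zero hq hμ) (radO_zero_le_two_pi hq)

end Alternative

end Summit.QuantumFields.BalabanUV.Beta.GAN24.StripLegApriori

end
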